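/-
Copyright (c) 2026 the pub-hodgecm-mathlib formalisation cell (harness21).  Prover seat hodgecm-mathlib-LH4-p07 (g4), req620 Track A «(D-RAM) FOUR-FRAME» squad
(heir LEAD F0P3a-plan lineage; dealer LH4-plan lineage; MS ROAD A, Stage B₂ brick B7₂ (i)₂ «CORE-HANGING STRATA, TYPE 2 — THE EXACT POLARISATION SET», FILE (B);
Stage B lead LH4-p10 (g2); re-keyed on multiplicity by LH4-p11 (g2) 2026-09-04T00:53Z).  2026-09-04.
-/
import Summits.HodgeConjecture.HodgeConjecture.Theorems.F0P3cDyRamDiagonalCoreHangingPolarisationsTypeTwo   -- (A) (this seat): `isIntMatrix_smul_inv_fin_three_of_le`, `letters_of_isVertexLattice_two_latt_coreHanging`, `v_eq_of_fixed_of_bounds`; brings ★ p856270, ★ p855897, ★ p855737, ★ StrataDefs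
import HarnessLib

/-!
# Crux `H413`, MS ROAD A, STAGE B₂ brick B7₂ (i)₂, FILE (B): «CORE-HANGING STRATA, TYPE 2 — EVERY ADMISSIBLE TRIPLE OF LETTERS POLARISES; THE EXACT SET; THE CRITERION»

Cell `hodgecm-mathlib` (D-0151), FLOOR 0, crux item H413 = `stmt-HodgeConjecture-24833`; lane `--supports stmt-HodgeConjecture-24833 --as helper` (count-neutral).  THEOREMS ONLY
(no `def`, no instance, no notation, no `sorry`, default heartbeats).  Continuation of FILE (A) `F0P3cDyRamDiagonalCoreHangingPolarisationsTypeTwo` (same letters: frame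
`V = (1 0 0; x ϖ^ρ 0; xζ+y″ ϖ^ρζ ϖ^{2ρ+1})`, `x, ζ, y″, y = xζ+y″` units, `ρ ≥ 1`; `P := D₂`, `f := −(D₁ + D₂Nζ)∕D₂`, `g := (D₀ + Nx·D₁ + Ny·D₂)∕D₂`, `B := ζσy″ − σx·f`).
* §3 SUFFICIENCY `isVertexLattice_two_latt_coreHanging_of_letters`: ANY `σ`-fixed `P, f, g` with `|P| = |ϖ|^{−2ρ}`, (R) `|B| ≤ |ϖ|^ρ`, (COF) `|f·g + B·σB| ≤ |ϖ|^{2ρ+1}` give a type-2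
  polarisation `D = (P·g − Nx·D₁ − Ny·P, D₁ := −P(Nζ+f), P)` with `|Dᵢ| = |ϖ|^{−2ρ}` — ★ p09's explicit form `isVertexLattice_two_latt_hnf_glued_explicit` (`g = −BσB∕f` there) with
  `D₀` FREED and `s = 0`; the places where p09 used `s ≥ 2` are the unit letters of the stratum exactly as in ★ p855897: `|f| = 1` and `Nζ + f` a unit BECAUSE `σx(Nζ + f) = ζσy − B`
  and `y` is a unit; `|D₀| = |ϖ|^{−2ρ}` BECAUSE `−f·Nx + Ny″ ≡ σy″(y − 2xζ) (𝔭)` and `|2| ≤ |ϖ|`; `ϖ·G⁻¹` integral by (A) §1 from (COF).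
* §4 HEADS: **`isVertexLattice_two_latt_coreHanging_iff`** — THE EXACT SET `Δ₂(latt V)` (ramified letters `hfix`, `|ϖ| = exp(−1)`): for `σ`-fixed non-degenerate `D`,
  `latt V` is a type-2 vertex of `diag D` iff `|D₂| = |ϖ|^{−2ρ}` ∧ (R) ∧ (COF); and **`isTypeTwoPolarisable_latt_hnf_coreHanging_iff`** — non-empty ⟺ (R) (generic valued field;
  ⟹ is ★ p09's `exists_fixed_of_isTypeTwoPolarisable_latt_hnf_glued` at `s = 0`, ⟸ is §3 with `g := −BσB∕f`, `P := π₀^{−ρ}`) — the same letters as the type-0 criterion ★ p855897.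
HONEST LABEL.  Count-neutral; the census laws stay PROVER TARGETS until the MS assembly lands; `HC_CM` is proved only modulo the 7 printed citations (2 remaining named inputs:
hLiu418 = `stmt-HodgeConjecture-24832`, h413 = `stmt-HodgeConjecture-24833`) until rung 0 closes.

## References
* [Jacobowitz1962] R. Jacobowitz, *Hermitian forms over local fields*, Amer. J. Math. 84 (1962), §4, §7 (Gram matrices, modular lattices, dual bases).
* [Kottwitz1986BaseChangeUnits] R. Kottwitz, *Base change for unit elements of Hecke algebras*, Compositio Math. 60 (1986), §1 pp. 240–241 (fixed-lattice counting).
* [Serre1980Trees] J.-P. Serre, *Trees*, Springer (1980), Ch. II §1.1 (lattices `g·𝒪^N`, Hermite normal form).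
-/

set_option autoImplicit false

noncomputable section

namespace Summit.HodgeConjecture.HodgeConjecture.Cruxes.H413.F0P3cDyRamDiagonalCoreHangingCriterionTypeTwo

open Matrix
open Literature.NumberTheory.Automorphic Literature.NumberTheory.Automorphic.HermitianLattice Literature.NumberTheory.Automorphic.UnitaryGroup
open Literature.NumberTheory.Automorphic.UnitaryLatticeTree
open Summit.HodgeConjecture.HodgeConjecture.Cruxes.H413.F0P3cDyRamDiagonalTorusDefs
open Summit.HodgeConjecture.HodgeConjecture.Cruxes.H413.F0P3cDyRamDiagonalStableLatticeHNF
open Summit.HodgeConjecture.HodgeConjecture.Cruxes.H413.F0P3cDyRamDiagonalGluedTubeCriterion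
open Summit.HodgeConjecture.HodgeConjecture.Cruxes.H413.F0P3cDyRamDiagonalGluedTubeCriterionTypeTwo
open Summit.HodgeConjecture.HodgeConjecture.Cruxes.H413.F0P3cDyRamDiagonalCoreHangingCriterion
open Summit.HodgeConjecture.HodgeConjecture.Cruxes.H413.F0P3cDyRamDiagonalStrataDefs
open Summit.HodgeConjecture.HodgeConjecture.Cruxes.H413.F0P3cDyRamDiagonalCoreHangingPolarisationsTypeTwo
open scoped Valued WithZero Matrix MatrixGroups

variable {K : Type*} [Field K] [Valued K ℤᵐ⁰]

/-! ## §3  Sufficiency: every admissible triple of letters `(P, f, g)` is a type-2 polarisation -/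

/-- **SUFFICIENCY — THE GENERAL TYPE-2 POLARISATION OF THE CORE-HANGING FRAME** (`ρ ≥ 1`; `x, ζ, y″, y = xζ+y″` units; wild trace bound).  For ANY `σ`-fixed `P, f, g` with
`|P| = |ϖ|^{−2ρ}`, (R) `|ζσy″ − σx·f| ≤ |ϖ|^ρ` and (COF) `|f·g + (ζσy″ − σx·f)(σζ·y″ − x·f)| ≤ |ϖ|^{2ρ+1}`, the diagonal form `D = (D₀, D₁, P)`, `D₁ := −P(Nζ + f)`,
`D₀ := P·g − Nx·D₁ − Ny·P`, is `σ`-fixed, non-degenerate with `|Dᵢ| = |ϖ|^{−2ρ}`, and `latt V` is a type-2 vertex lattice of `diag D`: the Gram matrix has `G₀₀ = P·g`,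
`G₀₁ = ϖ^ρPB`, `G₁₀ = σ(ϖ^ρ)PσB`, `G₁₁ = −π₀^ρPf` (a unit: `|f| = 1` by (R)), five entries in `𝔭`, `|det G| = |ϖ|²` (`|D₁| = |ϖ|^{−2ρ}` as `σx(Nζ+f) = ζσy − B`, `y` a unit;
`|D₀| = |ϖ|^{−2ρ}` as `−fNx + Ny″ ≡ σy″(y − 2xζ) (𝔭)`, `|2| ≤ |ϖ|`), and the `(2,2)` cofactor `−π₀^ρP²(fg + BσB)` in `𝔭` by (COF) (§1).
[cite: Jacobowitz1962, §7] [cite: Kottwitz1986BaseChangeUnits, §1 pp. 240–241] -/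
theorem isVertexLattice_two_latt_coreHanging_of_letters {σ : K →+* K} (hσ : ∀ a, σ (σ a) = a) (hvσ : ∀ a, Valued.v (σ a) = Valued.v a)
    {ϖ : K} (hϖ0 : ϖ ≠ 0) (hϖ1 : Valued.v ϖ < 1) (hTr : ∀ a : K, Valued.v (a + σ a) ≤ Valued.v ϖ * Valued.v a)
    (ρ : ℕ) (hρ : 1 ≤ ρ) {x ζ y'' : K} (hx : Valued.v x = 1) (hζ : Valued.v ζ = 1) (hy'' : Valued.v y'' = 1) (hy : Valued.v (x * ζ + y'') = 1)
    (V : GL (Fin 3) K) (hV : (V : Matrix (Fin 3) (Fin 3) K) = !![1, 0, 0; x, ϖ ^ ρ, 0; x * ζ + y'', ϖ ^ ρ * ζ, ϖ ^ (2 * ρ + 1)])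
    {P f g : K} (hσP : σ P = P) (hvP : Valued.v P = (Valued.v ϖ ^ (2 * ρ))⁻¹) (hf : σ f = f) (hR : Valued.v (ζ * σ y'' - σ x * f) ≤ Valued.v ϖ ^ ρ)
    (hσg : σ g = g) (hcof : Valued.v (f * g + (ζ * σ y'' - σ x * f) * (σ ζ * y'' - x * f)) ≤ Valued.v ϖ ^ (2 * ρ + 1))
    {D₁ D₀ : K} (hD₁ : D₁ = -(P * (ζ * σ ζ + f))) (hD₀ : D₀ = P * g - (σ x * D₁ * x + σ (x * ζ + y'') * P * (x * ζ + y''))) :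
    (∀ i, σ ((![D₀, D₁, P] : Fin 3 → K) i) = (![D₀, D₁, P] : Fin 3 → K) i ∧ (![D₀, D₁, P] : Fin 3 → K) i ≠ 0) ∧
      (∀ i, Valued.v ((![D₀, D₁, P] : Fin 3 → K) i) = (Valued.v ϖ ^ (2 * ρ))⁻¹) ∧
      IsVertexLattice σ ϖ (Matrix.diagonal ![D₀, D₁, P]) 2 (latt (V : Matrix (Fin 3) (Fin 3) K)) := by
  set c : ℕ := 2 * ρ + 1 with hc
  have hvϖ : 0 < Valued.v ϖ := (Valuation.pos_iff _).2 hϖ0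
  have hϖ1' : Valued.v ϖ ≤ 1 := hϖ1.le
  have hpowle : ∀ n : ℕ, Valued.v ϖ ^ n ≤ 1 := fun n => pow_le_one₀ zero_le hϖ1'
  have hϖρ1 : Valued.v ϖ ^ ρ < 1 := pow_lt_one₀ zero_le hϖ1 (by omega)
  have h2 : Valued.v (2 : K) < 1 := (v_two_le_of_trace_bound hTr).trans_lt hϖ1
  set E2 : ℤᵐ⁰ := Valued.v ϖ ^ (2 * ρ) with hE2
  have hE20 : E2 ≠ 0 := pow_ne_zero _ hvϖ.ne'
  have hE2pos : 0 < E2 := pow_pos hvϖ _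
  -- `|f| = 1`
  set B : K := ζ * σ y'' - σ x * f with hB
  have h1 : Valued.v (ζ * σ y'') = 1 := by rw [map_mul, hζ, hvσ, hy'', one_mul]
  have hBlt : Valued.v B < 1 := hR.trans_lt hϖρ1
  have hvxf : Valued.v (σ x * f) = 1 := by
    have e : σ x * f = ζ * σ y'' + -B := by rw [hB]; ring
    rw [e, Valuation.map_add_eq_of_lt_left _ (by rwa [Valuation.map_neg, h1]), h1]
  have hvf : Valued.v f = 1 := by rw [map_mul, hvσ, hx, one_mul] at hvxf; exact hvxf
  have hf0 : f ≠ 0 := fun h => by rw [h, map_zero] at hvf; exact zero_ne_one hvf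
  -- `σB` and its valuation
  have hσB : σ B = σ ζ * y'' - x * f := by rw [hB, map_sub, map_mul, map_mul, hσ, hσ, hf]
  have hvS : Valued.v (σ ζ * y'' - x * f) = Valued.v B := by rw [← hσB, hvσ]
  -- the unit `Nζ + f` (uses `|y| = 1`)
  set y : K := x * ζ + y'' with hydef
  set Nζ : K := ζ * σ ζ with hNζ
  have hvNζ : Valued.v Nζ = 1 := by rw [hNζ, map_mul, hvσ, hζ, one_mul]
  have hσNζ : σ Nζ = Nζ := by rw [hNζ, map_mul, hσ, mul_comm]
  have hkey : σ x * (Nζ + f) = ζ * σ y + -B := by rw [hydef, hNζ, hB, map_add, map_mul]; ring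
  have hvζσy : Valued.v (ζ * σ y) = 1 := by rw [map_mul, hζ, hvσ, hy, one_mul]
  have hvNf : Valued.v (Nζ + f) = 1 := by
    have h' : Valued.v (σ x * (Nζ + f)) = 1 := by
      rw [hkey, Valuation.map_add_eq_of_lt_left _ (by rwa [Valuation.map_neg, hvζσy]), hvζσy]
    rw [map_mul, hvσ, hx, one_mul] at h'; exact h'
  -- the uniformiser of `F`
  set π₀ : K := ϖ * σ ϖ with hπ₀
  have hvπ₀ : Valued.v π₀ = Valued.v ϖ ^ 2 := by rw [hπ₀, map_mul, hvσ, sq]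
  have hP0 : P ≠ 0 := fun h => by rw [h, map_zero] at hvP; exact (inv_ne_zero hE20) hvP.symm
  have hvϖc : Valued.v (ϖ ^ c) = E2 * Valued.v ϖ := by rw [map_pow, hc, pow_succ]
  have hPc : E2⁻¹ * (E2 * Valued.v ϖ) = Valued.v ϖ := by rw [← mul_assoc, inv_mul_cancel₀ hE20, one_mul]
  -- `D₁`
  have hvD₁ : Valued.v D₁ = E2⁻¹ := by rw [hD₁, Valuation.map_neg, map_mul, hvP, hvNf, mul_one]
  have hD₁0 : D₁ ≠ 0 := fun h => by rw [h, map_zero] at hvD₁; exact (inv_ne_zero hE20) hvD₁.symm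
  have hσD₁ : σ D₁ = D₁ := by rw [hD₁, map_neg, map_mul, map_add, hσP, hσNζ, hf]
  -- `|g| ≤ |ϖ|^{2ρ}` from (COF)
  have hvBB : Valued.v (B * (σ ζ * y'' - x * f)) ≤ E2 := by
    rw [map_mul, hvS, hE2, show 2 * ρ = ρ + ρ by ring, pow_add]; exact mul_le_mul' hR hR
  have hvg : Valued.v g ≤ E2 := by
    have e : g = f⁻¹ * ((f * g + B * (σ ζ * y'' - x * f)) - B * (σ ζ * y'' - x * f)) := by field_simp; ring
    rw [e, map_mul, map_inv₀, hvf, inv_one, one_mul]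
    exact v_sub_le_of_le (hcof.trans (by rw [hE2, pow_succ]; exact mul_le_of_le_one_right' hϖ1')) hvBB
  -- `D₀` and `|D₀| = |ϖ|^{−2ρ}`
  have hσD₀ : σ D₀ = D₀ := by
    rw [hD₀]; simp only [map_sub, map_add, map_mul, hσ, hσP, hσD₁, hσg, hydef]; ring
  have hvNx : Valued.v (σ x * x) = 1 := by rw [map_mul, hvσ, hx, one_mul]
  have hD₀eq : D₀ = P * (-(-(f * (σ x * x)) + σ y'' * y'') + (g - (σ (x * ζ) * y'' + σ (σ (x * ζ) * y'')))) := by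
    rw [hD₀, hD₁, hydef, hNζ]; simp only [map_add, map_mul, hσ]; ring
  have hvmain : Valued.v (-(f * (σ x * x)) + σ y'' * y'') = 1 := by
    have e : -(f * (σ x * x)) + σ y'' * y'' = σ y'' * (y - 2 * (x * ζ)) + x * B := by rw [hydef, hB]; ring
    have hu : Valued.v (σ y'' * (y - 2 * (x * ζ))) = 1 := by
      rw [map_mul, hvσ, hy'', one_mul, sub_eq_add_neg,
        Valuation.map_add_eq_of_lt_left _ (by rw [Valuation.map_neg, map_mul, map_mul, hx, hζ, mul_one, mul_one, hy]; exact h2), hy]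
    have hsmall : Valued.v (x * B) < Valued.v (σ y'' * (y - 2 * (x * ζ))) := by rw [hu, map_mul, hx, one_mul]; exact hBlt
    rw [e, v_add_eq_of_lt hsmall, hu]
  have hvrest : Valued.v (g - (σ (x * ζ) * y'' + σ (σ (x * ζ) * y''))) < 1 := by
    refine (Valuation.map_sub _ _ _).trans_lt (max_lt (hvg.trans_lt (pow_lt_one₀ zero_le hϖ1 (by omega))) ?_)
    refine (hTr _).trans_lt ?_
    rw [map_mul, hvσ, map_mul, hx, hζ, one_mul, one_mul, hy'', mul_one]
    exact hϖ1
  have hvD₀ : Valued.v D₀ = E2⁻¹ := by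
    rw [hD₀eq, map_mul, hvP, v_add_eq_of_lt (by rw [Valuation.map_neg, hvmain]; exact hvrest), Valuation.map_neg, hvmain, mul_one]
  have hD₀0 : D₀ ≠ 0 := fun h => by rw [h, map_zero] at hvD₀; exact (inv_ne_zero hE20) hvD₀.symm
  -- the diagonal form
  set D : Fin 3 → K := ![D₀, D₁, P] with hDdef
  have hD0 : D 0 = D₀ := rfl; have hD1 : D 1 = D₁ := rfl; have hD2 : D 2 = P := rfl
  refine ⟨fun i => ?_, fun i => ?_, ?_⟩
  · fin_cases i; exacts [⟨hσD₀, hD₀0⟩, ⟨hσD₁, hD₁0⟩, ⟨hσP, hP0⟩]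
  · fin_cases i; exacts [hvD₀, hvD₁, hvP]
  -- the Gram matrix, entry by entry
  have hG := formCongr_hnf_diagonal σ D x y (ϖ ^ ρ * ζ) (ϖ ^ ρ) (ϖ ^ c) V (by rw [hV])
  rw [hD0, hD1, hD2] at hG
  have e00 : D₀ + σ x * D₁ * x + σ y * P * y = P * g := by rw [hD₀]; ring
  have e01 : σ x * D₁ * ϖ ^ ρ + σ y * P * (ϖ ^ ρ * ζ) = ϖ ^ ρ * (P * B) := by
    rw [hD₁, hydef, hNζ, hB, map_add, map_mul]; ring
  have e10 : σ (ϖ ^ ρ) * D₁ * x + σ (ϖ ^ ρ * ζ) * P * y = σ (ϖ ^ ρ) * (P * (σ ζ * y'' - x * f)) := by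
    rw [hD₁, hydef, hNζ, map_mul]; ring
  have e11 : σ (ϖ ^ ρ) * D₁ * ϖ ^ ρ + σ (ϖ ^ ρ * ζ) * P * (ϖ ^ ρ * ζ) = -(π₀ ^ ρ * P * f) := by
    rw [hD₁, hNζ, hπ₀, map_mul, map_pow, mul_pow]; ring
  have hvϖρ : Valued.v (ϖ ^ ρ) = Valued.v ϖ ^ ρ := map_pow _ _ _
  have hvσϖρ : Valued.v (σ (ϖ ^ ρ)) = Valued.v ϖ ^ ρ := by rw [hvσ, map_pow]
  have hvσϖc : Valued.v (σ (ϖ ^ c)) = E2 * Valued.v ϖ := by rw [hvσ, hvϖc]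
  have hE2split : E2 = Valued.v ϖ ^ ρ * Valued.v ϖ ^ ρ := by rw [hE2, ← pow_add]; congr 1; ring
  have hvy : Valued.v y ≤ 1 := hy.le
  -- the four bounds of the upper-left block
  have h00 : Valued.v (D₀ + σ x * D₁ * x + σ y * P * y) ≤ 1 := by
    rw [e00, map_mul, hvP]
    calc E2⁻¹ * Valued.v g ≤ E2⁻¹ * E2 := mul_le_mul_right hvg _
      _ = 1 := inv_mul_cancel₀ hE20
  have hPB : Valued.v ϖ ^ ρ * (E2⁻¹ * Valued.v B) ≤ 1 :=
    calc Valued.v ϖ ^ ρ * (E2⁻¹ * Valued.v B) ≤ Valued.v ϖ ^ ρ * (E2⁻¹ * Valued.v ϖ ^ ρ) := mul_le_mul_right (mul_le_mul_right hR _) _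
      _ = (Valued.v ϖ ^ ρ * Valued.v ϖ ^ ρ) * E2⁻¹ := by ac_rfl
      _ = 1 := by rw [← hE2split, mul_inv_cancel₀ hE20]
  have h01 : Valued.v (σ x * D₁ * ϖ ^ ρ + σ y * P * (ϖ ^ ρ * ζ)) ≤ 1 := by
    rw [e01, map_mul, map_mul, hvϖρ, hvP]; exact hPB
  have h10 : Valued.v (σ (ϖ ^ ρ) * D₁ * x + σ (ϖ ^ ρ * ζ) * P * y) ≤ 1 := by
    rw [e10, map_mul, map_mul, hvσϖρ, hvP, hvS]; exact hPB
  have h11 : Valued.v (σ (ϖ ^ ρ) * D₁ * ϖ ^ ρ + σ (ϖ ^ ρ * ζ) * P * (ϖ ^ ρ * ζ)) ≤ 1 := by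
    rw [e11, Valuation.map_neg, map_mul, map_mul, map_pow, hvπ₀, hvP, hvf, ← pow_mul, ← hE2, mul_one, mul_inv_cancel₀ hE20]
  -- the five entries in `𝔭`
  have h02 : Valued.v (σ y * P * ϖ ^ c) ≤ Valued.v ϖ := by
    rw [map_mul, map_mul, hvσ, hvP, hvϖc, mul_assoc, hPc]; exact mul_le_of_le_one_left' hvy
  have h12 : Valued.v (σ (ϖ ^ ρ * ζ) * P * ϖ ^ c) ≤ Valued.v ϖ := by
    rw [map_mul, map_mul, hvσ, map_mul, hvϖρ, hζ, mul_one, hvP, hvϖc, mul_assoc, hPc]; exact mul_le_of_le_one_left' (hpowle ρ)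
  have h20 : Valued.v (σ (ϖ ^ c) * P * y) ≤ Valued.v ϖ := by
    rw [map_mul, map_mul, hvσϖc, hvP, mul_comm (E2 * Valued.v ϖ) E2⁻¹, hPc]; exact mul_le_of_le_one_right' hvy
  have h21 : Valued.v (σ (ϖ ^ c) * P * (ϖ ^ ρ * ζ)) ≤ Valued.v ϖ := by
    rw [map_mul, map_mul, hvσϖc, hvP, mul_comm (E2 * Valued.v ϖ) E2⁻¹, hPc, map_mul, hvϖρ, hζ, mul_one]
    exact mul_le_of_le_one_right' (hpowle ρ)
  have h22 : Valued.v (σ (ϖ ^ c) * P * ϖ ^ c) ≤ Valued.v ϖ := by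
    rw [map_mul, map_mul, hvσϖc, hvP, mul_comm (E2 * Valued.v ϖ) E2⁻¹, hPc, map_pow]; exact mul_le_of_le_one_right' (hpowle c)
  -- the `(2,2)` cofactor lies in `𝔭`
  have hcof' : Valued.v ((D₀ + σ x * D₁ * x + σ y * P * y) * (σ (ϖ ^ ρ) * D₁ * ϖ ^ ρ + σ (ϖ ^ ρ * ζ) * P * (ϖ ^ ρ * ζ)) -
      (σ x * D₁ * ϖ ^ ρ + σ y * P * (ϖ ^ ρ * ζ)) * (σ (ϖ ^ ρ) * D₁ * x + σ (ϖ ^ ρ * ζ) * P * y)) ≤ Valued.v ϖ := by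
    have hrk : (D₀ + σ x * D₁ * x + σ y * P * y) * (σ (ϖ ^ ρ) * D₁ * ϖ ^ ρ + σ (ϖ ^ ρ * ζ) * P * (ϖ ^ ρ * ζ)) -
        (σ x * D₁ * ϖ ^ ρ + σ y * P * (ϖ ^ ρ * ζ)) * (σ (ϖ ^ ρ) * D₁ * x + σ (ϖ ^ ρ * ζ) * P * y) =
        -(π₀ ^ ρ * P ^ 2 * (f * g + B * (σ ζ * y'' - x * f))) := by
      rw [e00, e01, e10, e11, hπ₀, map_pow, mul_pow]; ring
    rw [hrk, Valuation.map_neg, map_mul, map_mul, map_pow, hvπ₀, ← pow_mul, show 2 * ρ = ρ * 2 by ring, map_pow, hvP]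
    rw [show ρ * 2 = 2 * ρ by ring, ← hE2]
    calc E2 * E2⁻¹ ^ 2 * Valued.v (f * g + B * (σ ζ * y'' - x * f)) ≤ E2 * E2⁻¹ ^ 2 * Valued.v ϖ ^ (2 * ρ + 1) := mul_le_mul_right hcof _
      _ = (E2 * E2⁻¹) * (E2⁻¹ * E2) * Valued.v ϖ := by rw [sq, pow_succ, ← hE2]; ac_rfl
      _ = Valued.v ϖ := by rw [mul_inv_cancel₀ hE20, inv_mul_cancel₀ hE20, one_mul, one_mul]
  -- integrality of `G`
  have hGint : IsIntMatrix (formCongr σ V (Matrix.diagonal D)) := by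
    rw [hG]
    exact isIntMatrix_of_fin_three h00 h01 (h02.trans hϖ1') h10 h11 (h12.trans hϖ1') (h20.trans hϖ1') (h21.trans hϖ1') (h22.trans hϖ1')
  -- the determinant `|det G| = |ϖ|²`
  have hdet : Valued.v (formCongr σ V (Matrix.diagonal D)).det = Valued.v ϖ ^ 2 := by
    rw [det_formCongr_diagonal, det_coe_hnf x y (ϖ ^ ρ * ζ) (ϖ ^ ρ) (ϖ ^ c) V (by rw [hV]), hD0, hD1, hD2]
    simp only [map_mul, hvσ, hvD₀, hvD₁, hvP, hvϖρ, hvϖc]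
    set A := Valued.v ϖ ^ ρ with hA
    have hA0 : A ≠ 0 := pow_ne_zero _ hvϖ.ne'
    calc A * (E2 * Valued.v ϖ) * (E2⁻¹ * E2⁻¹ * E2⁻¹) * (A * (E2 * Valued.v ϖ))
        = (A * A * E2⁻¹) * (E2 * E2⁻¹) * (E2 * E2⁻¹) * (Valued.v ϖ * Valued.v ϖ) := by ac_rfl
      _ = Valued.v ϖ ^ 2 := by rw [← hE2split, mul_inv_cancel₀ hE20, one_mul, one_mul, one_mul, sq]
  have hdet' := hdet
  rw [hG] at hdet'
  have hinv : IsIntMatrix (ϖ • (formCongr σ V (Matrix.diagonal D))⁻¹) := by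
    rw [hG]
    exact isIntMatrix_smul_inv_fin_three_of_le hϖ0 hϖ1' hdet' h00 h01 h10 h11 h02 h12 h20 h21 h22 hcof'
  exact (isVertexLattice_latt_iff_of_v σ hvσ hϖ0 (Matrix.diagonal D) 2 V).2 ⟨hGint, hinv, hdet⟩

/-! ## §4  Heads -/

/-- **THE EXACT SET `Δ₂(latt V)` OF TYPE-2 POLARISATIONS OF THE CORE-HANGING FRAME** (MEMO v2.1 §T2.3 at `s = 0`; the object counted by ★ StrataDefs ED. 3 `polarisationCount σ ϖ 2`).
Ramified quadratic datum letters (`σ` an involution with `|σ·| = |·|`, fixed elements of even valuation `hfix`, `|ϖ| = exp(−1)`, the wild trace bound), `ρ ≥ 1`, `x, ζ, y″, xζ+y″` units.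
For a `σ`-fixed non-degenerate `D`: `latt V` is a type-2 vertex of `diag D` **iff** `|D₂| = |ϖ|^{−2ρ}` ∧ (R) `|ζσy″ − σx·f| ≤ |ϖ|^ρ` ∧ (COF) `|f·g + (ζσy″ − σx·f)(σζ·y″ − x·f)| ≤ |ϖ|^{2ρ+1}`,
where `f := −(D₁ + D₂Nζ)∕D₂`, `g := (D₀ + Nx·D₁ + Ny·D₂)∕D₂`. [cite: Jacobowitz1962, §7] [cite: Kottwitz1986BaseChangeUnits, §1 pp. 240–241] -/
theorem isVertexLattice_two_latt_coreHanging_iff {σ : K →+* K} (hσ : ∀ a, σ (σ a) = a) (hvσ : ∀ a, Valued.v (σ a) = Valued.v a)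
    (hfix : ∀ x : K, σ x = x → x ≠ 0 → ∃ n : ℤ, Valued.v x = WithZero.exp (2 * n)) {ϖ : K} (hϖ : Valued.v ϖ = WithZero.exp (-1 : ℤ))
    (hTr : ∀ a : K, Valued.v (a + σ a) ≤ Valued.v ϖ * Valued.v a)
    (ρ : ℕ) (hρ : 1 ≤ ρ) {x ζ y'' : K} (hx : Valued.v x = 1) (hζ : Valued.v ζ = 1) (hy'' : Valued.v y'' = 1) (hy : Valued.v (x * ζ + y'') = 1)
    (V : GL (Fin 3) K) (hV : (V : Matrix (Fin 3) (Fin 3) K) = !![1, 0, 0; x, ϖ ^ ρ, 0; x * ζ + y'', ϖ ^ ρ * ζ, ϖ ^ (2 * ρ + 1)])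
    {D : Fin 3 → K} (hD : ∀ i, σ (D i) = D i ∧ D i ≠ 0) :
    IsVertexLattice σ ϖ (Matrix.diagonal D) 2 (latt (V : Matrix (Fin 3) (Fin 3) K)) ↔
      Valued.v (D 2) = (Valued.v ϖ ^ (2 * ρ))⁻¹ ∧
      Valued.v (ζ * σ y'' - σ x * (-(D 1 + D 2 * (ζ * σ ζ)) / D 2)) ≤ Valued.v ϖ ^ ρ ∧
      Valued.v ((-(D 1 + D 2 * (ζ * σ ζ)) / D 2) * ((D 0 + σ x * D 1 * x + σ (x * ζ + y'') * D 2 * (x * ζ + y'')) / D 2) +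
          (ζ * σ y'' - σ x * (-(D 1 + D 2 * (ζ * σ ζ)) / D 2)) * (σ ζ * y'' - x * (-(D 1 + D 2 * (ζ * σ ζ)) / D 2))) ≤ Valued.v ϖ ^ (2 * ρ + 1) := by
  have hϖ0 : ϖ ≠ 0 := fun h0 => by rw [h0, map_zero] at hϖ; exact WithZero.coe_ne_zero hϖ.symm
  have hϖ1 : Valued.v ϖ < 1 := by rw [hϖ, ← WithZero.exp_zero, WithZero.exp_lt_exp]; norm_num
  set f : K := -(D 1 + D 2 * (ζ * σ ζ)) / D 2 with hf
  set g : K := (D 0 + σ x * D 1 * x + σ (x * ζ + y'') * D 2 * (x * ζ + y'')) / D 2 with hg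
  constructor
  · intro hvert
    obtain ⟨ha, hb, -, -, hR, hcof⟩ := letters_of_isVertexLattice_two_latt_coreHanging hσ hvσ hϖ0 hϖ1.le ρ hx.le hζ.le hy V hV hD hvert hf hg
    exact ⟨v_eq_of_fixed_of_bounds hfix hϖ ρ (hD 2).1 (hD 2).2 ha hb, hR, hcof⟩
  · rintro ⟨hvP, hR, hcof⟩
    have hD2 : D 2 ≠ 0 := (hD 2).2
    have hσf : σ f = f := by
      rw [hf, map_div₀, map_neg, map_add, map_mul, map_mul, hσ, (hD 1).1, (hD 2).1, mul_comm (σ ζ) ζ]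
    have hσg : σ g = g := by
      rw [hg, map_div₀, map_add, map_add, map_mul, map_mul, map_mul, map_mul, hσ, hσ, (hD 0).1, (hD 1).1, (hD 2).1]
      congr 1; ring
    have hD₁ : D 1 = -(D 2 * (ζ * σ ζ + f)) := by rw [hf]; field_simp; ring
    have hD₀ : D 0 = D 2 * g - (σ x * D 1 * x + σ (x * ζ + y'') * D 2 * (x * ζ + y'')) := by rw [hg]; field_simp; ring
    have h := (isVertexLattice_two_latt_coreHanging_of_letters hσ hvσ hϖ0 hϖ1 hTr ρ hρ hx hζ hy'' hy V hV (hD 2).1 hvP hσf hR hσg hcof hD₁ hD₀).2.2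
    have hDeq : (![D 0, D 1, D 2] : Fin 3 → K) = D := by ext i; fin_cases i <;> rfl
    rwa [hDeq] at h

/-- **TYPE-2 POLARISABLE ⟺ (R) ON THE CORE-HANGING STRATUM** (generic valued field; MEMO v2.1 §T2.3 at `s = 0`, the twin of ★ p09's `isTypeTwoPolarisable_latt_hnf_glued_iff`):
`latt (1 0 0; x ϖ^ρ 0; xζ+y″ ϖ^ρζ ϖ^{2ρ+1})` with units `x, ζ, y″, xζ + y″`, `ρ ≥ 1`, is a type-2 vertex lattice of SOME non-degenerate `σ`-fixed diagonal form iff `ζσ(y″)∕σ(x)` is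
`σ`-fixed modulo `𝔭^ρ` — the SAME letters as the type-0 criterion ★ p855897 `isDualisableLattice_latt_hnf_coreHanging_iff` (⟹ ★ p09 at `s = 0`; ⟸ §3 with `g := −BσB∕f`,
`P := π₀^{−ρ}`). [cite: Jacobowitz1962, §7] [cite: Kottwitz1986BaseChangeUnits, §1 pp. 240–241] -/
theorem isTypeTwoPolarisable_latt_hnf_coreHanging_iff {σ : K →+* K} (hσ : ∀ a, σ (σ a) = a) (hvσ : ∀ a, Valued.v (σ a) = Valued.v a)
    {ϖ : K} (hϖ0 : ϖ ≠ 0) (hϖ1 : Valued.v ϖ < 1) (hTr : ∀ a : K, Valued.v (a + σ a) ≤ Valued.v ϖ * Valued.v a)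
    (ρ : ℕ) (hρ : 1 ≤ ρ) {x ζ y'' : K} (hx : Valued.v x = 1) (hζ : Valued.v ζ = 1) (hy'' : Valued.v y'' = 1) (hy : Valued.v (x * ζ + y'') = 1)
    (V : GL (Fin 3) K) (hV : (V : Matrix (Fin 3) (Fin 3) K) = !![1, 0, 0; x, ϖ ^ ρ, 0; x * ζ + y'', ϖ ^ ρ * ζ, ϖ ^ (2 * ρ + 1)]) :
    IsTypeTwoPolarisable σ ϖ (latt (V : Matrix (Fin 3) (Fin 3) K)) ↔ ∃ f : K, σ f = f ∧ Valued.v (ζ * σ y'' - σ x * f) ≤ Valued.v ϖ ^ ρ := by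
  constructor
  · intro hM
    have hV0 : (V : Matrix (Fin 3) (Fin 3) K) = !![1, 0, 0; x, ϖ ^ ρ, 0; x * ζ + y'', ϖ ^ ρ * ζ, ϖ ^ (2 * ρ + 1 + 0)] := by rw [Nat.add_zero]; exact hV
    have h := exists_fixed_of_isTypeTwoPolarisable_latt_hnf_glued hσ hvσ hϖ0 hϖ1.le ρ 0 hx.le hζ.le hy''.le V hV0 hM
    rwa [Nat.add_zero] at h
  · rintro ⟨f, hf, hR⟩
    have hvϖ : 0 < Valued.v ϖ := (Valuation.pos_iff _).2 hϖ0
    -- `|f| = 1`, so `f ≠ 0`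
    have h1 : Valued.v (ζ * σ y'') = 1 := by rw [map_mul, hζ, hvσ, hy'', one_mul]
    have hBlt : Valued.v (ζ * σ y'' - σ x * f) < 1 := hR.trans_lt (pow_lt_one₀ zero_le hϖ1 (by omega))
    have hvxf : Valued.v (σ x * f) = 1 := by
      have e : σ x * f = ζ * σ y'' + -(ζ * σ y'' - σ x * f) := by ring
      rw [e, Valuation.map_add_eq_of_lt_left _ (by rwa [Valuation.map_neg, h1]), h1]
    have hvf : Valued.v f = 1 := by rw [map_mul, hvσ, hx, one_mul] at hvxf; exact hvxf
    have hf0 : f ≠ 0 := fun h => by rw [h, map_zero] at hvf; exact zero_ne_one hvf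
    -- the letters `P := π₀^{−ρ}`, `g := −BσB∕f`
    set P : K := ((ϖ * σ ϖ) ^ ρ)⁻¹ with hP
    have hσϖ0 : σ ϖ ≠ 0 := fun h => hϖ0 (by rw [← hσ ϖ, h, map_zero])
    have hσP : σ P = P := by rw [hP, map_inv₀, map_pow, map_mul, hσ, mul_comm]
    have hvP : Valued.v P = (Valued.v ϖ ^ (2 * ρ))⁻¹ := by rw [hP, map_inv₀, map_pow, map_mul, hvσ, ← sq, ← pow_mul]
    set g : K := -((ζ * σ y'' - σ x * f) * (σ ζ * y'' - x * f)) / f with hg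
    have hσg : σ g = g := by
      rw [hg, map_div₀, map_neg, map_mul, map_sub, map_sub, map_mul, map_mul, map_mul, map_mul, hσ, hσ, hσ, hf]; ring
    have hcof : Valued.v (f * g + (ζ * σ y'' - σ x * f) * (σ ζ * y'' - x * f)) ≤ Valued.v ϖ ^ (2 * ρ + 1) := by
      have e : f * g + (ζ * σ y'' - σ x * f) * (σ ζ * y'' - x * f) = 0 := by rw [hg]; field_simp; ring
      rw [e, map_zero]; exact zero_le
    obtain ⟨hDfix, -, hvert⟩ := isVertexLattice_two_latt_coreHanging_of_letters hσ hvσ hϖ0 hϖ1 hTr ρ hρ hx hζ hy'' hy V hV hσP hvP hf hR hσg hcof rfl rfl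
    exact ⟨_, hDfix, hvert⟩

end Summit.HodgeConjecture.HodgeConjecture.Cruxes.H413.F0P3cDyRamDiagonalCoreHangingCriterionTypeTwo

end
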